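import Literature.Geometry.Riemannian.BamlerTangentFlowAtInfinity
import HarnessLib

/-!
# Stub `stub_orbifoldTangentFlow` of line `ancient-sphere-rigidity` — closed modulo the named fact

Crux `EntropyRung.SubcylindricalRecognition` (stmt-SmoothPoincare4-10869), line `ancient-sphere-rigidity`,
skeleton r5/r6. The registered stub `stub_orbifoldTangentFlow` (Bamler's orbifold tangent flow at `-∞` of a
non-collapsed sequence of compact 4-dimensional Ricci flows, smooth export) is VERBATIM the named fact
`Literature.Geometry.Riemannian.bamler_orbifoldTangentFlowAtInfinity_four`
(Literature/Geometry/Riemannian/BamlerTangentFlowAtInfinity.lean; Bamler 2020a Prop. 5.2 / Thm. 10.1,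
2020b, 2020c Thms 2.4, 2.9, 2.16, 2.40, 2.46), so the conditional closing registered as
`stub_orbifoldTangentFlow_of` is the identity — exactly as `stub_singularFlow_of` closes `stub_singularFlow`
modulo `ricciFlow_shortTime_existence` and `perelman_muEntropy_monotone`.
-/

noncomputable section

open scoped Manifold ContDiff Topology ENNReal NNReal
open Set MeasureTheory
open Literature.Geometry.Lorentzian Literature.Geometry.Riemannian

namespace Summit.SmoothPoincare4.SmoothPoincare4.Theorems.SubcylindricalRecognition.AncientSphereRigidity

/-- **Stub `stub_orbifoldTangentFlow` (line `ancient-sphere-rigidity`, r5), CLOSED MODULO the named fact**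
`Literature.Geometry.Riemannian.bamler_orbifoldTangentFlowAtInfinity_four`: the registered signature is the
fact verbatim. [cite: Bamler2020Structure, §2.7 Thm 2.40; §2.10 Thm 2.46] -/
theorem stub_orbifoldTangentFlow_of :
    Literature.Geometry.Riemannian.bamler_orbifoldTangentFlowAtInfinity_four →
    ∀ (M : Type) [TopologicalSpace M] [T2Space M] [SecondCountableTopology M]
      [ChartedSpace (EuclideanSpace ℝ (Fin 4)) M] [IsManifold (𝓡 4) ∞ M] [CompactSpace M]
      [ConnectedSpace M] [T3Space M] [MeasurableSpace M] [BorelSpace M]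
      (A : ℕ → ℝ)
      (gk : ℕ → ℝ → PseudoRiemannianMetric (𝓡 4) ∞ (EuclideanSpace ℝ (Fin 4)) (TangentSpace (𝓡 4) : M → Type _))
      (covk : ℕ → ℝ → CovariantDerivative (𝓡 4) (EuclideanSpace ℝ (Fin 4)) (TangentSpace (𝓡 4) : M → Type _))
      (xk : ℕ → M) (F c : ℝ), 0 < c →
      (∀ k : ℕ, (k : ℝ) ≤ A k) →
      (∀ k, IsRicciFlow (gk k) (covk k) (Set.Icc (-(A k)) 0)) →
      (∀ k, ∀ t ∈ Set.Icc (-(A k)) 0, (gk k t).IsRiemannian) →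
      (∀ k, ∀ t ∈ Set.Icc (-(A k)) 0, CurvatureBoundedBy (gk k t) (covk k t) 1) →
      (∀ k, ∃ X Y Z W : TangentSpace (𝓡 4) (xk k),
        (gk k 0).val (xk k) X X ≤ 1 ∧ (gk k 0).val (xk k) Y Y ≤ 1 ∧
        (gk k 0).val (xk k) Z Z ≤ 1 ∧ (gk k 0).val (xk k) W W ≤ 1 ∧
        c ≤ |(gk k 0).curvatureForm (covk k 0) (xk k) X Y Z W|) →
      (∀ k, ∀ t ∈ Set.Icc (-(A k)) 0, ∀ τ : ℝ, 0 < τ → ((F : ℝ) : EReal) ≤ (gk k t).muEntropy (covk k t) τ) →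
      ∃ (S : Type) (_ : TopologicalSpace S) (_ : T2Space S) (_ : SecondCountableTopology S)
        (_ : ChartedSpace (EuclideanSpace ℝ (Fin 4)) S) (_ : IsManifold (𝓡 4) ∞ S)
        (_ : T3Space S) (_ : MeasurableSpace S) (_ : BorelSpace S)
        (gS : PseudoRiemannianMetric (𝓡 4) ∞ (EuclideanSpace ℝ (Fin 4)) (TangentSpace (𝓡 4) : S → Type _))
        (_ : gS.HasLeviCivita) (f : S → ℝ) (hS : gS.IsRiemannian) (W : ℝ)
        (ι : Type) (kc : ι → ℕ) (rc Λc : ι → ℝ)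
        (gc : ι → EuclideanSpace ℝ (Fin 4) →
          (EuclideanSpace ℝ (Fin 4) →L[ℝ] EuclideanSpace ℝ (Fin 4) →L[ℝ] ℝ)),
        ContMDiff (𝓡 4) 𝓘(ℝ, ℝ) ∞ f ∧
        (∀ (x : S) (X Y : TangentSpace (𝓡 4) x),
          gS.ricci x X Y + gS.hessian f x X Y = (1 / 2 : ℝ) * gS.val x X Y) ∧
        (∀ x : S, gS.scalarCurvature x + gS.gradSq f x = f x - W) ∧
        ∫⁻ x, ENNReal.ofReal (Real.exp (-f x))
            ∂(riemannianMeasure (gS.toContMDiffRiemannianMetric hS)) =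
          ENNReal.ofReal (16 * Real.pi ^ 2) ∧
        F ≤ W ∧ W < 0 ∧
        ((∀ x : S, 0 < gS.scalarCurvature x) ∨ Nonempty ι) ∧
        (∀ i, 2 ≤ kc i ∧ 0 < rc i ∧ 0 ≤ Λc i ∧
          ContDiffOn ℝ ∞ (gc i) (Metric.ball 0 (rc i)) ∧
          (∀ v w : EuclideanSpace ℝ (Fin 4), gc i 0 v w = inner ℝ v w) ∧
          (∀ y ∈ Metric.ball (0 : EuclideanSpace ℝ (Fin 4)) (rc i), ∀ v w, gc i y v w = gc i y w v) ∧
          (∀ y ∈ Metric.ball (0 : EuclideanSpace ℝ (Fin 4)) (rc i), ∀ v, v ≠ 0 → 0 < gc i y v v)) ∧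
        (∀ i, ∀ ε η : ℝ, 0 < ε → ε < rc i → 0 < η →
          ∃ (k : ℕ) (t : ℝ) (_ : t ∈ Set.Icc (-(A k)) 0) (Q : ℝ) (_ : 0 < Q)
            (Φ : EuclideanSpace ℝ (Fin 4) → M) (ρ : M → ℝ),
            ContMDiffOn (𝓡 4) (𝓡 4) ∞ Φ (Metric.ball 0 (rc i) \ Metric.closedBall 0 ε) ∧
            IsOpen (Φ '' (Metric.ball 0 (rc i) \ Metric.closedBall 0 ε)) ∧
            (∀ y ∈ Metric.ball (0 : EuclideanSpace ℝ (Fin 4)) (rc i) \ Metric.closedBall 0 ε,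
              Function.Injective (mfderiv (𝓡 4) (𝓡 4) Φ y)) ∧
            (∀ y ∈ Metric.ball (0 : EuclideanSpace ℝ (Fin 4)) (rc i) \ Metric.closedBall 0 ε,
              (Φ ⁻¹' {Φ y} ∩ (Metric.ball 0 (rc i) \ Metric.closedBall 0 ε)).ncard = kc i) ∧
            ContMDiffOn (𝓡 4) 𝓘(ℝ, ℝ) ∞ ρ (Φ '' (Metric.ball 0 (rc i) \ Metric.closedBall 0 ε)) ∧
            (∀ y ∈ Metric.ball (0 : EuclideanSpace ℝ (Fin 4)) (rc i) \ Metric.closedBall 0 ε,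
              ρ (Φ y) = ‖y‖ ^ 2) ∧
            (∀ y ∈ Metric.ball (0 : EuclideanSpace ℝ (Fin 4)) (rc i) \ Metric.closedBall 0 ε,
              ∀ v : EuclideanSpace ℝ (Fin 4),
                (1 - η) * gc i y v v ≤
                  Q * (gk k t).val (Φ y) (mfderiv (𝓡 4) (𝓡 4) Φ y v) (mfderiv (𝓡 4) (𝓡 4) Φ y v) ∧
                Q * (gk k t).val (Φ y) (mfderiv (𝓡 4) (𝓡 4) Φ y v) (mfderiv (𝓡 4) (𝓡 4) Φ y v) ≤
                  (1 + η) * gc i y v v) ∧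
            (∀ y ∈ Metric.ball (0 : EuclideanSpace ℝ (Fin 4)) (rc i) \ Metric.closedBall 0 ε,
              |(gk k t).scalarCurvatureWith (covk k t) (Φ y)| ≤ Q * Λc i)) ∧
        (IsEmpty ι → ConnectedSpace S) ∧
        (IsEmpty ι → ∀ (x : S) (r : NNReal), IsCompact {y : S | gS.edist hS x y ≤ r}) ∧
        (IsEmpty ι → CompactSpace S → ∃ φ : S → M, ContMDiff (𝓡 4) (𝓡 4) ∞ φ ∧ Function.Injective φ ∧
          ∀ x : S, Function.Injective (mfderiv (𝓡 4) (𝓡 4) φ x)) :=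
  fun h ↦ h

end Summit.SmoothPoincare4.SmoothPoincare4.Theorems.SubcylindricalRecognition.AncientSphereRigidity

end
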